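import Summits.QuantumFields.BalabanUV.Beta.FP.TowerFAnchorRow
import Summits.QuantumFields.BalabanUV.Beta.FP.KernelPeriodisationFibWoundLetter
import Summits.QuantumFields.BalabanUV.Beta.FP.TowerNParityRowsEven
import Summits.QuantumFields.BalabanUV.Beta.CombChartWardSockets

/-!
# `BalabanUV.Beta.FP.TowerFWindingRow` — road «FP», binder row D1, ROUTE T (β1), (H5-F box): **THE END's F-WINDING LETTER `hWFw` BY NAME** — at skeleton N's
# three-way F-tower (storey `1` := the `wStep Lc 1`-dressed LITERAL level-0 pair, storey `k+2` := the `wStep Lc (k+2)`-dressed N-system `k+1`; `𝒲F` RAW for `htr`,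
# `𝒲bF` := its source-wound EVEN half) v10 `StepRecursionFeedNestedNamedI`'s binder `hWFw` (L.252) —
# `trace (perF T_B (AF (n+1)) · perF T_B (dper T_B (𝒲bF (n+1) B μ 0 ν z))) − trace (perF T_B (AF (n+1)) · perF T_B (dper T_B (𝒲F (n+1) μ 0 ν z))) → 0` — IS A THEOREM,
# CHARACTER FOR CHARACTER, at every storey

WHY (located).  Road g58 census `ENDSKEL-BINDERS-v10N.md` cdd9cc1f: after (H5-F) proper the END at the record displays 38 hypotheses, five of them the
(H5-F box) letters `hWFw hHF₁ hQF₁ hHF₂ hQF₂`; `hWFw` is the only ANALYTIC one (INBOX [D1P3-G58-INBOX-1] item (3): «`hWFw` (winding) IS BY NAME NEXT … one new lemma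
`dressW_swap` … Fubini under the column decay × `VertexFamily₂` bound»).  The N-side twin `hWNw` is v10 L.377 (row PART 15c `winding_letter_evenHalf_of_swap` at an2's
`WN_swap`); on the F-side the END keeps `𝒲F` RAW (so that `htr` reads `hessKer (AN, VN, WN)` dressed — `TowerFTransportRow.htr_rec`) and winds its EVEN half in `𝒲bF`
(`TowerFWoundParities`), so the letter compares the wound even half with the raw member: both torus tadpole traces converge (PART 15c
`tendsto_trace_tadpole_evenHalf_of_swap`, leaf-side `KernelPeriodisationFibHessKer.tendsto_trace_tadpole'`) and the two limits `tadpole A W♮`, `tadpole A W` agree for a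
spread sgn-symmetric leg (road `SecondOrderTableEvenPart.tadpole_evenHalf`).  What PART 15c needs of the family is `VertexFamily₂` (FILE 3 ∕ FILE 6:
`exists_vertexFamilies_FRec ∕ _zero`) and the SWAP SYMMETRY — which the kernel-level step dressing PRESERVES (§1 `dressW_swap`: the two nested lattice sums of
`dressW_apply` exchanged by lit `KernelWard.tsum_comm_of_prodBound`, product majorant = column weight × (column weight · `VertexFamily₂` constant)).

WHAT ([folklore] lattice-sum bookkeeping + composition BY NAME; generic dimension `d` in §1; no `def`, no `def … : Prop`, nothing cited, 0 sorry).
* §1 `dressW_swap` (swap symmetry through the dressing), `trK_scaleK_of_trK_eq_sgnK` (equal fibre units on both sides keep `trK A = sgnK A`),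
  **`winding_letter_evenWound_of_swap`** — NamedC's `hWFw` SHAPE «source-wound EVEN half against the RAW member», for any growing torus ∕ source boxes, decaying
  torus-invariant sgn-symmetric leg and swap-symmetric `VertexFamily₂` family.
* §2 `FRecW_swap`, **`hWFw_rec`** — v10's binder `hWFw` (L.252) CHARACTER FOR CHARACTER under skeleton N's σ at the storeys `k+2`
  (`AF (n+1) ↦ scaleK σ⁻ σ⁻ (AN (Roots.ctr Lc) n)`, `𝒲F (n+1) ↦ scaleK σ′ σ′ (Lc⁸ • dressW (Lc^(n+1)) Lc (wStep Lc (n+1)) (WN (Roots.ctr Lc) Pn n))`, `𝒲bF (n+1) B ↦` its wound even half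
  on `Mc B`): leg letters `TowerFChartLetters.exists_decays_AF_rec ∕ hAFsh_rec` (→ `translate_invariant_of_shiftK` on `towerTorus Lc (fine Lc (Mc B)) (n+1) = Lc^(n+1)·(Lc·Mc B)`),
  `CompositeOneShotChartParity.trK_AN`; family letters `TowerFTransportRow.exists_vertexFamilies_FRec`, an2 `TowerNParityRowsEven.WN_swap` through `dressW_swap`.
* §3 `WGlit_swap` (every level `j`), `FZeroW_swap`, **`hWFw_zero`** — the same at storey `1` (leg `scaleK σ₀⁻ σ₀⁻ (GcombSh Lc 0)`: `TowerFAnchorRow.exists_decays_AF_zero ∕ hAFsh_zero`,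
  `CombChartWardSockets.trK_GcombSh`; family `TowerFAnchorRow.exists_vertexFamilies_FRec_zero`, the literal's `SpineRooted.WrecOf_swap` through
  `JsB12CombSh0_eq ∕ JsComb0Of_W ∕ WchartOf_GcombSh ∕ WchartOf_eq`).
Junction: `g59/rec/mkWFw.py` emits both statements from the twin's binder with the SAME generator strings as `g58/rec/mkEndSkel58.py --anchor`; skeleton O feeds
`hWFw := fun n => match n with | 0 => hWFw_zero … | k + 1 => hWFw_rec … (k + 1)` (END at the record 38 → 37).
WHAT THIS IS NOT: not the door-jet junctions `hHF₁ hQF₁ hHF₂ hQF₂` (the (C1)-class identities of the (H5-F box), with the row after v11's rooted re-cut); v10 ∕ the END NOT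
filed (policy); nothing of Bałaban's asserted, valued or discharged; 0 estimates beyond [folklore] geometric series BY NAME; 0∕4 row-D1 binders (hW ∕ hR ∕ D1Tel ∕ D1Rep);
ROOT M‴ p325680 ∕ P5c ∕ D6 untouched; NOT (C1), NOT (T-ID), NOT D1, NEVER «G-an2-4 closed», NOT BetaPertH, NOT continuum, NOT Clay.
HONEST DEPENDENCY (page 1, mandatory): continuum YM on T⁴ ⇐ BetaPertH ∧ nine spine estimates (0/9 proved); BetaPertH ⇐ (D1) ∧ (D4) ∧ CAP+tail;
G-an2-4 gates asym, D1 and NE2/3/4.  HONEST FRAMING (cell contract, verbatim): «discharging `BetaPertH` makes Bałaban's UV stability UNCONDITIONAL —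
a real constructive-QFT result; it is NOT the continuum limit and NOT the Clay problem.»  ABSOLUTE RULE (cell charter, verbatim): «No internally-minted
statement may enter as a cited fact. Every hypothesis is either kernel-proved in this package or a verbatim quotation of a PUBLISHED theorem with page
reference. The manuscript(s) under audit are NOT citable for their own disputed steps — they are the thing under adjudication; programme-internal
(2001/route/tribunal) claims are never citable.»  Road «FP» OWNER, b2b-balaban-beta-d1-p3 gen 59, 2026-08-29.  No existing file touched.
-/

noncomputable section

open scoped BigOperators Matrix Topology
open Finset Filter

namespace Summit.QuantumFields.BalabanUV.Beta.FP.TowerFWindingRow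

open Literature.MathematicalPhysics.QuantumFieldTheory
open Literature.MathematicalPhysics.QuantumFieldTheory.Balaban1983to89
open Literature.MathematicalPhysics.QuantumFieldTheory.Balaban1983to89.Beta
open B12Sec2to5 (l1 l1_nonneg)
open B4TorusKernel.MultiPeriod (translate)
open B5Prop11Plancherel (fine)
open ExpKernelCalculus (Site MKer Decays BiLoc VertexFamily₂ tadpole)
open DressedMomentNormalisation (EKer)
open HessKerRate (scaleK scaleK_apply)
open HessianTelescopingKKT (wStep)
open OneStepResolventKernel (Fib)
open KernelWard (ProdBound tsum_comm_of_prodBound)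
open Summit.QuantumFields.BalabanUV.Beta.TameKernelCalculus (trK trK_apply Spr)
open Summit.QuantumFields.BalabanUV.Beta.BorderedHessian (sgnK sgnK_apply)
open Summit.QuantumFields.BalabanUV.Beta.SymSecondOrderTablesAn1 (symTablesAn1S2)
open Summit.QuantumFields.BalabanUV.Beta.CompositeOneShotJetData (Roots Pins AN WN)
open Summit.QuantumFields.BalabanUV.Beta.CombChartStepJets (GcombSh JsB12CombSh0 JsB12CombSh0_eq JsComb0Of_W)
open Summit.QuantumFields.BalabanUV.Beta.ChartStepJets (WchartOf_eq WchartOf_GcombSh)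
open Summit.QuantumFields.BalabanUV.Beta.SpineRooted (WrecOf_swap)
open Summit.QuantumFields.BalabanUV.Beta.CombChartWardSockets (trK_GcombSh)
open Summit.QuantumFields.BalabanUV.Beta.NVertexParities (vertexFamilies_VN_WN)
open Summit.QuantumFields.BalabanUV.Beta.FP.CompositeOneShotChartParity (trK_AN)
open Summit.QuantumFields.BalabanUV.Beta.FP.TowerNParityRowsEven (WN_swap)
open Summit.QuantumFields.BalabanUV.Beta.FP.KernelPeriodisationFib (perF translate_invariant_of_shiftK)
open Summit.QuantumFields.BalabanUV.Beta.FP.KernelPeriodisationFibLoc (dper)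
open Summit.QuantumFields.BalabanUV.Beta.FP.KernelPeriodisationFibHessKer (tendsto_trace_tadpole')
open Summit.QuantumFields.BalabanUV.Beta.FP.KernelPeriodisationFibWoundLetter (tendsto_trace_tadpole_evenHalf_of_swap)
open Summit.QuantumFields.BalabanUV.Beta.FP.SecondOrderTableEvenPart (tadpole_evenHalf loc_of_biLoc)
open Summit.QuantumFields.BalabanUV.Beta.FP.TorusCompositeObjects (towerTorus towerTorus_apply)
open Summit.QuantumFields.BalabanUV.Beta.FP.KernelStepDressing (dressW dressW_apply)
open Summit.QuantumFields.BalabanUV.Beta.FP.KernelStepDressingHessKer (abs_col_le)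
open Summit.QuantumFields.BalabanUV.Beta.D1BFx.DressedBubbleBridge (summable_abs_of_expWeight)
open Summit.QuantumFields.BalabanUV.Beta.FP.TowerFChartLetters (hAFsh_rec exists_decays_AF_rec)
open Summit.QuantumFields.BalabanUV.Beta.FP.TowerFTransportRow (abs_wStep_le exists_vertexFamilies_FRec)
open Summit.QuantumFields.BalabanUV.Beta.FP.TowerFAnchorRow (hAFsh_zero exists_decays_AF_zero exists_vertexFamilies_FRec_zero)

variable {d : ℕ}

/-! ## §1 Swap symmetry through the dressing; units and sgn-symmetry; the winding letter «wound even half against the raw member» -/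

section Generic

variable {N : ℕ} [NeZero N] (L : ℕ) {w : EKer (d + 1)} {Cw δw : ℝ}
  {W : Fin (d + 1) → Site (d + 1) → Fin (d + 1) → Site (d + 1) → MKer (d + 1) (Fib d)} {C2 δ : ℝ}

/-- [folklore] **`dressW_swap` — THE KERNEL-LEVEL STEP DRESSING PRESERVES THE SWAP SYMMETRY** `W ν y′ μ y = W μ y ν y′`: in `dressW_apply`'s double lattice sum the
finite indices are exchanged by `Finset.sum_comm` and the two `Σ'` by lit `KernelWard.tsum_comm_of_prodBound` — product majorant `|w e ν (L•z′ − t)| · (|w c μ (L•z − t′)| · C₂)`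
(the column entries are absolutely summable, `DressedBubbleBridge.summable_abs_of_expWeight`; the `VertexFamily₂` members are bounded by their constant). -/
theorem dressW_swap (hw : ∀ c a u, |w c a u| ≤ Cw * Real.exp (-δw * l1 u)) (hδw : 0 < δw)
    (hW : VertexFamily₂ W N C2 δ) (hδ : 0 ≤ δ) (hs : ∀ μ y ν y', W ν y' μ y = W μ y ν y')
    (μ : Fin (d + 1)) (z : Site (d + 1)) (ν : Fin (d + 1)) (z' : Site (d + 1)) :
    dressW N L w W ν z' μ z = dressW N L w W μ z ν z' := by
  funext x y a b
  rw [dressW_apply, dressW_apply, Finset.sum_comm]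
  refine Finset.sum_congr rfl fun c _ => Finset.sum_congr rfl fun e _ => ?_
  have hC2 : 0 ≤ C2 := (hW c z e z').nonneg a
  have hbd : ∀ t t' : Site (d + 1), |W c t' e t x y a b| ≤ C2 := fun t t' => by
    refine ((hW c t' e t) x y a b).trans (mul_le_of_le_one_right hC2 (Real.exp_le_one_iff.mpr ?_))
    nlinarith [l1_nonneg (x - (N : ℤ) • t'), l1_nonneg (y - (N : ℤ) • t)]
  have hPB : ProdBound (fun t t' : Site (d + 1) => w e ν ((L : ℤ) • z' - t) * (w c μ ((L : ℤ) • z - t') * W c t' e t x y a b)) := by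
    refine ⟨fun t => |w e ν ((L : ℤ) • z' - t)|, fun t' => |w c μ ((L : ℤ) • z - t')| * C2,
      summable_abs_of_expWeight (p := (L : ℤ) • z') (fun t => abs_col_le hw e ν _ t) hδw,
      (summable_abs_of_expWeight (p := (L : ℤ) • z) (fun t' => abs_col_le hw c μ _ t') hδw).mul_right C2,
      fun _ => abs_nonneg _, fun _ => mul_nonneg (abs_nonneg _) hC2, fun t t' => ?_⟩
    rw [abs_mul, abs_mul]
    exact mul_le_mul_of_nonneg_left (mul_le_mul_of_nonneg_left (hbd t t') (abs_nonneg _)) (abs_nonneg _)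
  calc (∑' t : Site (d + 1), w e ν ((L : ℤ) • z' - t) * ∑' t' : Site (d + 1), w c μ ((L : ℤ) • z - t') * W e t c t' x y a b)
      = ∑' t : Site (d + 1), ∑' t' : Site (d + 1), w e ν ((L : ℤ) • z' - t) * (w c μ ((L : ℤ) • z - t') * W c t' e t x y a b) := by
        refine tsum_congr fun t => ?_
        rw [← tsum_mul_left]
        exact tsum_congr fun t' => by rw [hs c t' e t]
    _ = ∑' t' : Site (d + 1), ∑' t : Site (d + 1), w e ν ((L : ℤ) • z' - t) * (w c μ ((L : ℤ) • z - t') * W c t' e t x y a b) :=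
        tsum_comm_of_prodBound hPB
    _ = ∑' t' : Site (d + 1), w c μ ((L : ℤ) • z - t') * ∑' t : Site (d + 1), w e ν ((L : ℤ) • z' - t) * W c t' e t x y a b := by
        refine tsum_congr fun t' => ?_
        rw [← tsum_mul_left]
        exact tsum_congr fun t => by ring

/-- [folklore] **equal fibre units on both sides keep sgn-symmetry**: `trK A = sgnK A ⟹ trK (scaleK s s A) = sgnK (scaleK s s A)`. -/
theorem trK_scaleK_of_trK_eq_sgnK {A : MKer (d + 1) (Fib d)} (s : Fib d → ℝ) (hAt : trK A = sgnK A) :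
    trK (scaleK s s A) = sgnK (scaleK s s A) := by
  funext x y a b
  have h := congrFun (congrFun (congrFun (congrFun hAt x) y) a) b
  rw [trK_apply, sgnK_apply] at h
  rw [trK_apply, scaleK_apply, sgnK_apply, scaleK_apply, h]
  ring

variable {A : MKer (d + 1) (Fib d)} {CA α : ℝ}

/-- [folklore] **`winding_letter_evenWound_of_swap` — NamedC's `hWFw` SHAPE «SOURCE-WOUND EVEN HALF AGAINST THE RAW MEMBER», DISCHARGED**: torus boxes `T k` and source
boxes `Mc k` growing, a decaying `T_kℤ`-invariant sgn-symmetric leg `A` (`trK A = sgnK A`), `W` a swap-symmetric `VertexFamily₂` family (blocking `N ≥ 1`, rate `δ > 0`); then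
`trace (perF (T k) A * perF (T k) (dper (T k) (x w ↦ Σ'_e W♮ μ y ν (z + Mc_k∘e) x w))) − trace (perF (T k) A * perF (T k) (dper (T k) (W μ y ν z))) → 0`
(PART 15c `tendsto_trace_tadpole_evenHalf_of_swap` minus `tendsto_trace_tadpole'`; the limits `tadpole A W♮ = tadpole A W` by `tadpole_evenHalf`). -/
theorem winding_letter_evenWound_of_swap (T Mc : ℕ → (Fin (d + 1) → ℕ)) [∀ k μ, NeZero (T k μ)] [∀ k μ, NeZero (Mc k μ)]
    (hT : ∀ K : ℕ, ∀ᶠ k in atTop, ∀ i, K ≤ T k i) (hMc : ∀ K : ℕ, ∀ᶠ k in atTop, ∀ i, K ≤ Mc k i)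
    (hA : Decays A CA α) (hα : 0 < α) (hAt : trK A = sgnK A)
    (hAinv : ∀ k (m x y : Fin (d + 1) → ℤ) (a b : Fib d), A (translate (T k) x m) (translate (T k) y m) a b = A x y a b)
    (hs : ∀ μ y ν y', W ν y' μ y = W μ y ν y') (hW : VertexFamily₂ W N C2 δ) (hδ : 0 < δ)
    (μ : Fin (d + 1)) (y : Fin (d + 1) → ℤ) (ν : Fin (d + 1)) (z : Fin (d + 1) → ℤ) :
    Tendsto (fun k => Matrix.trace (perF (T k) A * perF (T k) (dper (T k) (fun x w a b => ∑' e,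
          ((1 / 2 : ℝ) • (W μ y ν (translate (Mc k) z e) + sgnK (trK (W μ y ν (translate (Mc k) z e))))) x w a b)))
        - Matrix.trace (perF (T k) A * perF (T k) (dper (T k) (W μ y ν z)))) atTop (𝓝 0) := by
  have h1 := tendsto_trace_tadpole_evenHalf_of_swap T Mc hT hMc hA hα hAinv hs hW hδ μ y ν z
  have h2 := tendsto_trace_tadpole' T hT hA hα hAinv (hW μ y ν z) hδ
  have h := h1.sub h2
  rwa [tadpole_evenHalf ⟨CA, α, hα, hA⟩ hAt (loc_of_biLoc (hW μ y ν z) hδ), sub_self] at h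

end Generic

/-! ## §2 THE WINDING LETTER AT THE RECORD, storeys `k+2`: v10's `hWFw` (L.252) under skeleton N's σ -/

section Record

variable (Lc : ℕ) [NeZero Lc] (Pn : Pins) (uF : ℕ → ℝ)

/-- [folklore] **the END's σ′-scaled dressed second-order family is swap-symmetric** (an2 `WN_swap` through §1 `dressW_swap` at `TowerFTransportRow.abs_wStep_le` and an2's
`vertexFamilies_VN_WN`; the units and `Lc⁸` act on the value). -/
theorem FRecW_swap (n : ℕ) (μ : Fin (3 + 1)) (y : Site (3 + 1)) (ν : Fin (3 + 1)) (y' : Site (3 + 1)) :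
    (fun μ y ν y' => scaleK (Sum.elim (fun _ : Fin (3 + 1) => (1 : ℝ)) (fun _ : Fin (3 + 1) => (uF n))) (Sum.elim (fun _ : Fin (3 + 1) => (1 : ℝ)) (fun _ : Fin (3 + 1) => (uF n))) ((Lc : ℝ) ^ 8 • dressW (Lc ^ (n + 1)) Lc (wStep Lc (n + 1)) (WN (Roots.ctr Lc) Pn n) μ y ν y')) ν y' μ y
      = (fun μ y ν y' => scaleK (Sum.elim (fun _ : Fin (3 + 1) => (1 : ℝ)) (fun _ : Fin (3 + 1) => (uF n))) (Sum.elim (fun _ : Fin (3 + 1) => (1 : ℝ)) (fun _ : Fin (3 + 1) => (uF n))) ((Lc : ℝ) ^ 8 • dressW (Lc ^ (n + 1)) Lc (wStep Lc (n + 1)) (WN (Roots.ctr Lc) Pn n) μ y ν y')) μ y ν y' := by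
  obtain ⟨δw, Cw0, hδw, -, hw⟩ := abs_wStep_le Lc (n + 1)
  obtain ⟨Cv, Cw, δ, hδ, -, hW⟩ := vertexFamilies_VN_WN (Roots.ctr Lc) Pn n
  show scaleK _ _ ((Lc : ℝ) ^ 8 • dressW (Lc ^ (n + 1)) Lc (wStep Lc (n + 1)) (WN (Roots.ctr Lc) Pn n) ν y' μ y) = _
  rw [dressW_swap (N := Lc ^ (n + 1)) Lc (fun c a u => hw c a u) hδw hW hδ.le (WN_swap (Roots.ctr Lc) Pn n) μ y ν y']

variable (huF : ∀ j, 1 ≤ uF j) (Mc : ℕ → (Fin (3 + 1) → ℕ)) [∀ B μ, NeZero (Mc B μ)] (hMc : ∀ K : ℕ, ∀ᶠ B in atTop, ∀ i, K ≤ Mc B i)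
include huF hMc

/-- [folklore] **`hWFw` AT THE RECORD, storeys `k+2`** — v10 `StepRecursionFeedNestedNamedI.d1Tel_JcComp_ctr_namedI`'s binder `hWFw` (L.252) CHARACTER FOR CHARACTER under
σ = {`(AF (n + 1))` ↦ `(scaleK (Sum.elim 1 (uF n)⁻¹) (Sum.elim 1 (uF n)⁻¹) (AN (Roots.ctr Lc) n))`, `(𝒲F (n + 1))` ↦ the σ′-scaled `Lc⁸ • dressW (Lc ^ (n + 1)) Lc (wStep Lc (n + 1)) (WN (Roots.ctr Lc) Pn n)`,
`(𝒲bF (n + 1)) B` ↦ its source-wound even half on `Mc B`}: §1 `winding_letter_evenWound_of_swap` on the torus `towerTorus Lc (fine Lc (Mc B)) (n + 1) = Lc^(n+1)·(Lc·Mc B)` fed the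
chart's letters (`exists_decays_AF_rec`, `hAFsh_rec` → `translate_invariant_of_shiftK`, `trK_AN` → `trK_scaleK_of_trK_eq_sgnK`) and the family's (`exists_vertexFamilies_FRec`, `FRecW_swap`). -/
theorem hWFw_rec (n : ℕ) (μ ν : Fin (3 + 1)) (z : Fin (3 + 1) → ℤ) : Tendsto (fun B : ℕ => Matrix.trace (perF (towerTorus Lc (fine Lc (Mc B)) (n + 1)) (scaleK (Sum.elim (fun _ : Fin (3 + 1) => (1 : ℝ)) (fun _ : Fin (3 + 1) => (uF n)⁻¹)) (Sum.elim (fun _ : Fin (3 + 1) => (1 : ℝ)) (fun _ : Fin (3 + 1) => (uF n)⁻¹)) (AN (Roots.ctr Lc) n)) * perF (towerTorus Lc (fine Lc (Mc B)) (n + 1)) (dper (towerTorus Lc (fine Lc (Mc B)) (n + 1)) ((fun μ y ν y' => (fun x z a b => ∑' e : Site (3 + 1), ((1 / 2 : ℝ) • ((fun μ y ν y' => scaleK (Sum.elim (fun _ : Fin (3 + 1) => (1 : ℝ)) (fun _ : Fin (3 + 1) => (uF n))) (Sum.elim (fun _ : Fin (3 + 1) => (1 : ℝ)) (fun _ : Fin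 (3 + 1) => (uF n))) ((Lc : ℝ) ^ 8 • dressW (Lc ^ (n + 1)) Lc (wStep Lc (n + 1)) (WN (Roots.ctr Lc) Pn n) μ y ν y')) μ y ν (translate (Mc B) y' e) + sgnK (trK ((fun μ y ν y' => scaleK (Sum.elim (fun _ : Fin (3 + 1) => (1 : ℝ)) (fun _ : Fin (3 + 1) => (uF n))) (Sum.elim (fun _ : Fin (3 + 1) => (1 : ℝ)) (fun _ : Fin (3 + 1) => (uF n))) ((Lc : ℝ) ^ 8 • dressW (Lc ^ (n + 1)) Lc (wStep Lc (n + 1)) (WN (Roots.ctr Lc) Pn n) μ y ν y')) μ y ν (translate (Mc B) y' e))))) x z a b)) μ 0 ν z))) - Matrix.trace (perF (towerTorus Lc (fine Lc (Mc B)) (n + 1)) (scaleK (Sum.elim (fun _ : Fin (3 + 1) => (1 : ℝ)) (fun _ : Fin (3 + 1) => (uF n)⁻¹)) (Sum.elim (fun _ : Fin (3 + 1) => (1 : ℝ)) (fun _ : Fin (3 + 1) => (uF n)⁻¹)) (AN (Roots.ctr Lc) n)) * perF (towerTorus Lc (fine Lc (Mc B)) (n + 1)) (dper (towerTorus Lc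 (fine Lc (Mc B)) (n + 1)) ((fun μ y ν y' => scaleK (Sum.elim (fun _ : Fin (3 + 1) => (1 : ℝ)) (fun _ : Fin (3 + 1) => (uF n))) (Sum.elim (fun _ : Fin (3 + 1) => (1 : ℝ)) (fun _ : Fin (3 + 1) => (uF n))) ((Lc : ℝ) ^ 8 • dressW (Lc ^ (n + 1)) Lc (wStep Lc (n + 1)) (WN (Roots.ctr Lc) Pn n) μ y ν y')) μ 0 ν z)))) atTop (𝓝 0) := by
  have hL0 : 0 < Lc := Nat.pos_of_ne_zero (NeZero.ne Lc)
  obtain ⟨αF, CAF, hαF, -, hAF⟩ := exists_decays_AF_rec Lc uF n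
  obtain ⟨CvF, CwF, δF, hδF, -, hWF⟩ := exists_vertexFamilies_FRec Lc Pn uF huF n
  have hT : ∀ K : ℕ, ∀ᶠ B in atTop, ∀ i, K ≤ towerTorus Lc (fine Lc (Mc B)) (n + 1) i :=
    fun K => (hMc K).mono fun B hB i => le_trans (hB i) (by
      rw [towerTorus_apply]
      exact le_trans (Nat.le_mul_of_pos_left _ hL0) (Nat.le_mul_of_pos_left _ (pow_pos hL0 _)))
  have hAinv : ∀ (B : ℕ) (m x y : Fin (3 + 1) → ℤ) (a b : Fib 3),
      scaleK (Sum.elim (fun _ : Fin (3 + 1) => (1 : ℝ)) (fun _ : Fin (3 + 1) => (uF n)⁻¹)) (Sum.elim (fun _ : Fin (3 + 1) => (1 : ℝ)) (fun _ : Fin (3 + 1) => (uF n)⁻¹)) (AN (Roots.ctr Lc) n)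
          (translate (towerTorus Lc (fine Lc (Mc B)) (n + 1)) x m) (translate (towerTorus Lc (fine Lc (Mc B)) (n + 1)) y m) a b
        = scaleK (Sum.elim (fun _ : Fin (3 + 1) => (1 : ℝ)) (fun _ : Fin (3 + 1) => (uF n)⁻¹)) (Sum.elim (fun _ : Fin (3 + 1) => (1 : ℝ)) (fun _ : Fin (3 + 1) => (uF n)⁻¹)) (AN (Roots.ctr Lc) n) x y a b :=
    fun B m x y a b => translate_invariant_of_shiftK (towerTorus Lc (fine Lc (Mc B)) (n + 1)) (hAFsh_rec Lc uF n)
      (fun i => ⟨Lc * Mc B i, by rw [towerTorus_apply]⟩) m x y a b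
  exact winding_letter_evenWound_of_swap (fun B => towerTorus Lc (fine Lc (Mc B)) (n + 1)) Mc hT hMc hAF hαF
    (trK_scaleK_of_trK_eq_sgnK _ (trK_AN (Roots.ctr Lc) n)) hAinv (FRecW_swap Lc Pn uF n) hWF hδF μ 0 ν z

end Record

/-! ## §3 THE WINDING LETTER AT THE RECORD, storey `1` (the dressed LITERAL): v10's `hWFw` at `n := 0` under skeleton N's σ -/

section Zero

variable (Lc : ℕ) [NeZero Lc] (hLc : Odd Lc) (N : ℕ) (cΛ cB : ℝ) (uF : ℕ → ℝ)

/-- [folklore] **THE LITERAL's SECOND-ORDER FAMILY IS SWAP-SYMMETRIC AT EVERY LEVEL `j`**: it IS `WrecOf … j` of the comb-chart slot recursion (`rfl` chain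
`JsB12CombSh0_eq ∕ JsComb0Of_W ∕ WchartOf_GcombSh ∕ WchartOf_eq`), swap-symmetric by `SpineRooted.WrecOf_swap` (lit `W2SymOfK_swap`).  The END's F-tower reads `j = 0`
(storey 1); a G-system taken at the literal top step would read `j = n + 1`. -/
theorem WGlit_swap (j : ℕ) (μ : Fin (3 + 1)) (y : Site (3 + 1)) (ν : Fin (3 + 1)) (y' : Site (3 + 1)) :
    (JsB12CombSh0 hLc N (symTablesAn1S2 3 Lc cΛ) cΛ cB j).W ν y' μ y = (JsB12CombSh0 hLc N (symTablesAn1S2 3 Lc cΛ) cΛ cB j).W μ y ν y' := by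
  rw [JsB12CombSh0_eq, JsComb0Of_W, ← WchartOf_GcombSh, WchartOf_eq]
  exact WrecOf_swap _ _ _ _ _ _ _ _ j μ y ν y'

/-- [folklore] **the END's σ′₀-scaled dressed literal family is swap-symmetric** (`WGlit_swap 0` through §1 `dressW_swap` at `abs_wStep_le Lc 1` and the jet record's own `loc₂`). -/
theorem FZeroW_swap (μ : Fin (3 + 1)) (y : Site (3 + 1)) (ν : Fin (3 + 1)) (y' : Site (3 + 1)) :
    (fun μ y ν y' => scaleK (Sum.elim (fun _ : Fin (3 + 1) => (1 : ℝ)) (fun _ : Fin (3 + 1) => (uF 0))) (Sum.elim (fun _ : Fin (3 + 1) => (1 : ℝ)) (fun _ : Fin (3 + 1) => (uF 0))) ((Lc : ℝ) ^ 8 • dressW Lc Lc (wStep Lc 1) (JsB12CombSh0 hLc N (symTablesAn1S2 3 Lc cΛ) cΛ cB 0).W μ y ν y')) ν y' μ y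
      = (fun μ y ν y' => scaleK (Sum.elim (fun _ : Fin (3 + 1) => (1 : ℝ)) (fun _ : Fin (3 + 1) => (uF 0))) (Sum.elim (fun _ : Fin (3 + 1) => (1 : ℝ)) (fun _ : Fin (3 + 1) => (uF 0))) ((Lc : ℝ) ^ 8 • dressW Lc Lc (wStep Lc 1) (JsB12CombSh0 hLc N (symTablesAn1S2 3 Lc cΛ) cΛ cB 0).W μ y ν y')) μ y ν y' := by
  obtain ⟨δw, Cw0, hδw, -, hw⟩ := abs_wStep_le Lc 1
  set J := JsB12CombSh0 hLc N (symTablesAn1S2 3 Lc cΛ) cΛ cB 0 with hJ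
  show scaleK _ _ ((Lc : ℝ) ^ 8 • dressW Lc Lc (wStep Lc 1) J.W ν y' μ y) = _
  rw [dressW_swap (N := Lc) Lc (fun c a u => hw c a u) hδw J.loc₂ J.δ_pos.le (WGlit_swap Lc hLc N cΛ cB 0) μ y ν y']

variable (huF : 1 ≤ uF 0) (Mc : ℕ → (Fin (3 + 1) → ℕ)) [∀ B μ, NeZero (Mc B μ)] (hMc : ∀ K : ℕ, ∀ᶠ B in atTop, ∀ i, K ≤ Mc B i)
include huF hMc

/-- [folklore] **`hWFw` AT THE RECORD, storey `1`** — v10's binder `hWFw` (L.252) at `n := 0` CHARACTER FOR CHARACTER under σ = {`(AF (n + 1))` ↦ `(scaleK σ₀⁻ σ₀⁻ (GcombSh Lc 0))`,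
`(𝒲F (n + 1))` ↦ the σ′₀-scaled `Lc⁸ • dressW Lc Lc (wStep Lc 1) (JsB12CombSh0 … 0).W`, `(𝒲bF (n + 1)) B` ↦ its source-wound even half on `Mc B`, `(n + 1)` ↦ `(0 + 1)`}: §1 on the torus
`towerTorus Lc (fine Lc (Mc B)) (0 + 1)` fed `exists_decays_AF_zero`, `hAFsh_zero` → `translate_invariant_of_shiftK`, `trK_GcombSh` → `trK_scaleK_of_trK_eq_sgnK`,
`exists_vertexFamilies_FRec_zero`, `FZeroW_swap`. -/
theorem hWFw_zero (μ ν : Fin (3 + 1)) (z : Fin (3 + 1) → ℤ) : Tendsto (fun B : ℕ => Matrix.trace (perF (towerTorus Lc (fine Lc (Mc B)) (0 + 1)) (scaleK (Sum.elim (fun _ : Fin (3 + 1) => (1 : ℝ)) (fun _ : Fin (3 + 1) => (uF 0)⁻¹)) (Sum.elim (fun _ : Fin (3 + 1) => (1 : ℝ)) (fun _ : Fin (3 + 1) => (uF 0)⁻¹)) (GcombSh (d := 3) Lc 0)) * perF (towerTorus Lc (fine Lc (Mc B)) (0 + 1)) (dper (towerTorus Lc (fine Lc (Mc B)) (0 +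 1)) ((fun μ y ν y' => (fun x z a b => ∑' e : Site (3 + 1), ((1 / 2 : ℝ) • ((fun μ y ν y' => scaleK (Sum.elim (fun _ : Fin (3 + 1) => (1 : ℝ)) (fun _ : Fin (3 + 1) => (uF 0))) (Sum.elim (fun _ : Fin (3 + 1) => (1 : ℝ)) (fun _ : Fin (3 + 1) => (uF 0))) ((Lc : ℝ) ^ 8 • dressW Lc Lc (wStep Lc 1) (JsB12CombSh0 hLc N (symTablesAn1S2 3 Lc cΛ) cΛ cB 0).W μ y ν y')) μ y ν (translate (Mc B) y' e) + sgnK (trK ((fun μ y ν y' => scaleK (Sum.elim (fun _ : Fin (3 + 1) => (1 : ℝ)) (fun _ : Fin (3 + 1) => (uF 0))) (Sum.elim (fun _ : Fin (3 + 1) => (1 : ℝ)) (fun _ : Fin (3 + 1) => (uF 0))) ((Lc : ℝ) ^ 8 • dressW Lc Lc (wStep Lc 1) (JsB12CombSh0 hLc N (symTablesAn1S2 3 Lc cΛ) cΛ cB 0).W μ y ν y')) μ y ν (translate (Mc B) y' e))))) x z a b)) μ 0 ν z))) - Matrix.trace (perF (towerTorus Lc (fine Lc (Mc B)) (0 + 1))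 (scaleK (Sum.elim (fun _ : Fin (3 + 1) => (1 : ℝ)) (fun _ : Fin (3 + 1) => (uF 0)⁻¹)) (Sum.elim (fun _ : Fin (3 + 1) => (1 : ℝ)) (fun _ : Fin (3 + 1) => (uF 0)⁻¹)) (GcombSh (d := 3) Lc 0)) * perF (towerTorus Lc (fine Lc (Mc B)) (0 + 1)) (dper (towerTorus Lc (fine Lc (Mc B)) (0 + 1)) ((fun μ y ν y' => scaleK (Sum.elim (fun _ : Fin (3 + 1) => (1 : ℝ)) (fun _ : Fin (3 + 1) => (uF 0))) (Sum.elim (fun _ : Fin (3 + 1) => (1 : ℝ)) (fun _ : Fin (3 + 1) => (uF 0))) ((Lc : ℝ) ^ 8 • dressW Lc Lc (wStep Lc 1) (JsB12CombSh0 hLc N (symTablesAn1S2 3 Lc cΛ) cΛ cB 0).W μ y ν y')) μ 0 ν z)))) atTop (𝓝 0) := by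
  have hL0 : 0 < Lc := Nat.pos_of_ne_zero (NeZero.ne Lc)
  obtain ⟨αF, CAF, hαF, -, hAF⟩ := exists_decays_AF_zero Lc uF
  obtain ⟨CvF, CwF, δF, hδF, -, hWF⟩ := exists_vertexFamilies_FRec_zero Lc hLc N cΛ cB uF huF
  have hT : ∀ K : ℕ, ∀ᶠ B in atTop, ∀ i, K ≤ towerTorus Lc (fine Lc (Mc B)) (0 + 1) i :=
    fun K => (hMc K).mono fun B hB i => le_trans (hB i) (by
      rw [towerTorus_apply]
      exact le_trans (Nat.le_mul_of_pos_left _ hL0) (Nat.le_mul_of_pos_left _ (pow_pos hL0 _)))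
  have hAinv : ∀ (B : ℕ) (m x y : Fin (3 + 1) → ℤ) (a b : Fib 3),
      scaleK (Sum.elim (fun _ : Fin (3 + 1) => (1 : ℝ)) (fun _ : Fin (3 + 1) => (uF 0)⁻¹)) (Sum.elim (fun _ : Fin (3 + 1) => (1 : ℝ)) (fun _ : Fin (3 + 1) => (uF 0)⁻¹)) (GcombSh (d := 3) Lc 0)
          (translate (towerTorus Lc (fine Lc (Mc B)) (0 + 1)) x m) (translate (towerTorus Lc (fine Lc (Mc B)) (0 + 1)) y m) a b
        = scaleK (Sum.elim (fun _ : Fin (3 + 1) => (1 : ℝ)) (fun _ : Fin (3 + 1) => (uF 0)⁻¹)) (Sum.elim (fun _ : Fin (3 + 1) => (1 : ℝ)) (fun _ : Fin (3 + 1) => (uF 0)⁻¹)) (GcombSh (d := 3) Lc 0) x y a b :=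
    fun B m x y a b => translate_invariant_of_shiftK (towerTorus Lc (fine Lc (Mc B)) (0 + 1)) (hAFsh_zero Lc uF)
      (fun i => ⟨Lc * Mc B i, by rw [towerTorus_apply]⟩) m x y a b
  exact winding_letter_evenWound_of_swap (fun B => towerTorus Lc (fine Lc (Mc B)) (0 + 1)) Mc hT hMc hAF hαF
    (trK_scaleK_of_trK_eq_sgnK _ (trK_GcombSh (d := 3) (Lc := Lc) 0)) hAinv (FZeroW_swap Lc hLc N cΛ cB uF) hWF hδF μ 0 ν z

end Zero

end Summit.QuantumFields.BalabanUV.Beta.FP.TowerFWindingRow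

end
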